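import Summits.CriticalPhenomena.SAWScalingLimit.Theses.SAWBrickWallHomotopy
import Summits.CriticalPhenomena.SAWScalingLimit.Theorems.SAWDevelopingMapHexTransferFlatRectangle
import Summits.CriticalPhenomena.SAWScalingLimit.Theorems.SAWDevelopingMapHexTransferFlatBoundaryScaling
import Summits.CriticalPhenomena.SAWScalingLimit.Theorems.SAWDevelopingMapHexTransferFlatUniformizerDeriv
import Summits.CriticalPhenomena.SAWScalingLimit.Theorems.SAWDevelopingMapHexTransferEllipseHullFamily
import Summits.CriticalPhenomena.SAWScalingLimit.Theorems.SAWDevelopingMapHexTransferStretchRigidityHulls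
import Literature.Probability.RandomPlanarGeometry.SLEExistenceNeEightHolds

/-!
# Stub `stub_stretchRigidity` of line `pin-the-shear` (crux stmt-CriticalPhenomena-14221):
# chordal SLE(8/3) admits no axis-stretch covariance (= item stmt-CriticalPhenomena-5793)

If `s > 0` and the axis stretch `Φ_s (x + iy) = x + i s y` pushes every chordal SLE(8/3) law of
every Dobrushin domain `D` to a chordal SLE(8/3) law of `Φ_s(D)`, then `s = 1`.

Proof (restriction formula on an explicit family of hulls at a flat marked point). Take the flat
square `F` of `stub_flatRectangle` (marked point `a = 0`, `F = ℍ` near `0`, and `Φ_s F` is again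
flat at `Φ_s 0 = 0`), an SLE(8/3) law `μ` of `F` and its image `μ' = (Φ_s)_* μ`, an SLE(8/3) law of
`Φ_s F` by hypothesis. For the half-ellipse hull `E(α, β)` centred at `1` with semi-axes `α`
(horizontal) and `β` (vertical), `0 < β < α < 1` — a member `ellHull (1-f) (1+f) ρ` of the tree's
Joukowski family (`f = √(α²-β²)`, `ρ = √((α-β)/(α+β))`, `ell_dict`) with restriction derivative
`g(α, β) = ellDeriv … < 1` — the avoidance events of the dilated hulls correspond under `Φ_s`:
`μ {Γ avoids ε E(α, β)} = μ' {Γ avoids ε E(α, sβ)}` (`avoid_stretch_eq`: `Φ_s⁻¹ (ε E(α, sβ)) = ε E(α, β)`).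
By the boundary scaling of restriction probabilities at a flat marked point
(`stub_flatBoundaryScaling`, fed by the regularity `stub_flatUniformizerDeriv` of the uniformizing
maps and the confocal room of `stub_ellipseHullFamily`), as `ε → 0⁺` the left side is squeezed
between `g^{5/8}` of the confocal neighbours of `E(α, β)` and the right side between those of
`E(α, sβ)`; continuity of `ellDeriv` in the Joukowski parameter gives `g(α, β) = g(α, sβ)`
(`ellDeriv_le_of_avoid`). Iterating along `t = min(s, 1/s) < 1` and flattening (`β → 0⁺`:
`g(α, tⁿβ) → 1`, `tendsto_ellDeriv_flattening`) forces `g(α, β) = 1`, contradicting `g(α, β) < 1`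
(`ellDeriv_lt_one`).
-/

noncomputable section

namespace Summit.CriticalPhenomena.SAWScalingLimit.Cruxes.HexTransfer.PinTheShear

open MeasureTheory Filter Topology Set
open scoped NNReal ENNReal
open Literature.Probability.RandomPlanarGeometry
open UpperHalfPlane (upperHalfPlaneSet)
open Summit.CriticalPhenomena.SAWScalingLimit.Theses

namespace Stretch

/-! ### The half-ellipse hulls `E(α, β)` centred at `1` in the Joukowski parametrisation -/

/-- **Dictionary.** For `0 < β < α < 1`, with `f = √(α² - β²)` and `ρ = √((α-β)/(α+β))`: the foci
`1 ∓ f` are ordered, `0 < ρ < 1`, the positivity condition `h · jLevel ρ < c` holds, and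
`ellHull (1-f) (1+f) ρ` is the closed upper half of the ellipse centred at `1` with semi-axes
`α`, `β`. -/
theorem ell_dict {α β : ℝ} (hβ : 0 < β) (hβα : β < α) (hα1 : α < 1) :
    1 - Real.sqrt (α ^ 2 - β ^ 2) < 1 + Real.sqrt (α ^ 2 - β ^ 2) ∧
    0 < Real.sqrt ((α - β) / (α + β)) ∧ Real.sqrt ((α - β) / (α + β)) < 1 ∧
    ellH (1 - Real.sqrt (α ^ 2 - β ^ 2)) (1 + Real.sqrt (α ^ 2 - β ^ 2)) *
        jLevel (Real.sqrt ((α - β) / (α + β))) <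
      ellC (1 - Real.sqrt (α ^ 2 - β ^ 2)) (1 + Real.sqrt (α ^ 2 - β ^ 2)) ∧
    ellHull (1 - Real.sqrt (α ^ 2 - β ^ 2)) (1 + Real.sqrt (α ^ 2 - β ^ 2))
        (Real.sqrt ((α - β) / (α + β))) =
      {z : ℂ | 0 ≤ z.im ∧ ((z.re - 1) / α) ^ 2 + (z.im / β) ^ 2 ≤ 1} := by
  obtain ⟨hf0, -, -, -⟩ := focal_data hβ hβα
  obtain ⟨hρ0, hρ1, -, -⟩ := rho_data hβ hβα
  obtain ⟨hA, hB, hpos⟩ := axes_data hβ hβα hα1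
  obtain ⟨hC, -⟩ := ellC_ellH_foci (Real.sqrt (α ^ 2 - β ^ 2))
  refine ⟨by linarith, hρ0, hρ1, hpos, ?_⟩
  rw [ellHull_eq_axis _ _ hρ0 hρ1]
  simp only [hA, hB, hC]

/-- `ellDeriv a b` is continuous at every `ρ ≠ 0` (it is `(1 - v₀²/ρ²)/(1 - v₀²)`). -/
theorem continuousAt_ellDeriv (a b : ℝ) {ρ : ℝ} (hρ : ρ ≠ 0) : ContinuousAt (ellDeriv a b) ρ := by
  have : ellDeriv a b = fun r ↦ (1 - ellNode a b ^ 2 / r ^ 2) / (1 - ellNode a b ^ 2) := rfl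
  rw [this]
  refine ContinuousAt.div_const (ContinuousAt.sub continuousAt_const ?_) _
  exact ContinuousAt.div continuousAt_const (continuousAt_id.pow 2) (pow_ne_zero 2 hρ)

/-- `jLevel ρ = ρ + ρ⁻¹` is continuous at every `ρ ≠ 0`. -/
theorem continuousAt_jLevel {ρ : ℝ} (hρ : ρ ≠ 0) : ContinuousAt jLevel ρ := by
  have : jLevel = fun r ↦ r + r⁻¹ := rfl
  rw [this]
  exact continuousAt_id.add (continuousAt_inv₀ hρ)

/-! ### The squeeze: equal avoidance probabilities force equal restriction derivatives -/

/-- **One-sided squeeze.** Let `F`, `F'` be Dobrushin domains flat at their first marked point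
`0`, with chordal SLE(8/3) laws `μ`, `μ'`, and let `B = ellHull a b ρ`, `B' = ellHull a' b' ρ'` be
half-ellipse hulls (positivity condition) whose dilates are avoided with the same probabilities:
`μ {Γ avoids ε B} = μ' {Γ avoids ε B'}` for all `ε > 0`. Then `ellDeriv a b ρ ≤ ellDeriv a' b' ρ'`.
Proof: otherwise pick `r < ρ` close (continuity of `ellDeriv`, positivity condition open) and
`ρ' < ρ₁' < 1` close with `ellDeriv a' b' ρ₁' < ellDeriv a b r`; the boundary scaling
`stub_flatBoundaryScaling` (with `stub_flatUniformizerDeriv` and the confocal room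
`exists_thickening_ellHull_subset`) gives, for some `ε > 0`,
`ellDeriv a b r ^ (5/8) ≤ μ {Γ avoids ε B} = μ' {Γ avoids ε B'} ≤ ellDeriv a' b' ρ₁' ^ (5/8)`. -/
theorem ellDeriv_le_of_avoid {F F' : DobrushinDomain} {r₀ r₀' : ℝ}
    (hr₀ : 0 < r₀) (hF0 : F.pt 0 = 0)
    (hflat : F.carrier ∩ Metric.ball (0 : ℂ) r₀ = upperHalfPlaneSet ∩ Metric.ball (0 : ℂ) r₀)
    (hr₀' : 0 < r₀') (hF'0 : F'.pt 0 = 0)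
    (hflat' : F'.carrier ∩ Metric.ball (0 : ℂ) r₀' = upperHalfPlaneSet ∩ Metric.ball (0 : ℂ) r₀')
    {μ μ' : Measure (CurveClass ℂ)} (hμ : IsSLELaw ((8 : ℝ≥0) / 3) F μ)
    (hμ' : IsSLELaw ((8 : ℝ≥0) / 3) F' μ')
    {a b ρ a' b' ρ' : ℝ} (hab : a < b) (h0 : 0 < ρ) (h1 : ρ < 1)
    (hB : ellH a b * jLevel ρ < ellC a b)
    (hab' : a' < b') (h0' : 0 < ρ') (h1' : ρ' < 1) (hB' : ellH a' b' * jLevel ρ' < ellC a' b')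
    (heq : ∀ ε : ℝ, 0 < ε →
      μ (CurveClass.rangeSubset ((fun z : ℂ => (ε : ℂ) * z) '' ellHull a b ρ)ᶜ) =
        μ' (CurveClass.rangeSubset ((fun z : ℂ => (ε : ℂ) * z) '' ellHull a' b' ρ')ᶜ)) :
    ellDeriv a b ρ ≤ ellDeriv a' b' ρ' := by
  by_contra hlt
  rw [not_le] at hlt
  have hh : 0 < ellH a b := ellH_pos hab
  have hh' : 0 < ellH a' b' := ellH_pos hab'
  have hcl : closure upperHalfPlaneSet = {z : ℂ | 0 ≤ z.im} := Complex.closure_setOf_lt_im 0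
  -- the midpoint `m`
  obtain ⟨m, hm1, hm2⟩ : ∃ m, ellDeriv a' b' ρ' < m ∧ m < ellDeriv a b ρ :=
    ⟨(ellDeriv a b ρ + ellDeriv a' b' ρ') / 2, by linarith, by linarith⟩
  -- `r < ρ` close: `m < ellDeriv a b r` and the positivity condition at `r`
  have hev1 : ∀ᶠ r in 𝓝 ρ, m < ellDeriv a b r :=
    (continuousAt_ellDeriv a b h0.ne').tendsto.eventually_const_lt hm2
  have hev2 : ∀ᶠ r in 𝓝 ρ, ellH a b * jLevel r < ellC a b :=
    (((continuousAt_jLevel h0.ne').tendsto).const_mul (ellH a b)).eventually_lt_const hB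
  have hev0 : ∀ᶠ r in 𝓝[<] ρ, r ∈ Ioo 0 ρ := Ioo_mem_nhdsLT h0
  obtain ⟨r, ⟨hr0, hrρ⟩, hmr, hBr⟩ :=
    (hev0.and ((hev1.and hev2).filter_mono nhdsWithin_le_nhds)).exists
  have hr1 : r < 1 := hrρ.trans h1
  -- `ρ' < ρ₁' < 1` close: `ellDeriv a' b' ρ₁' < m`
  have hev3 : ∀ᶠ t in 𝓝 ρ', ellDeriv a' b' t < m :=
    (continuousAt_ellDeriv a' b' h0'.ne').tendsto.eventually_lt_const hm1
  have hev3' : ∀ᶠ t in 𝓝[>] ρ', t ∈ Ioo ρ' 1 := Ioo_mem_nhdsGT h1'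
  obtain ⟨ρ₁', ⟨hρρ₁', hρ₁'1⟩, hρ₁'m⟩ :=
    (hev3'.and (hev3.filter_mono nhdsWithin_le_nhds)).exists
  have h0ρ₁' : 0 < ρ₁' := h0'.trans hρρ₁'
  have hBρ₁' : ellH a' b' * jLevel ρ₁' < ellC a' b' :=
    (mul_lt_mul_of_pos_left (jLevel_lt_jLevel h0' hρρ₁' hρ₁'1.le) hh').trans hB'
  -- `r' < ρ'` with the positivity condition (only needed to run the scaling on `F'`)
  have hev4 : ∀ᶠ t in 𝓝 ρ', ellH a' b' * jLevel t < ellC a' b' :=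
    (((continuousAt_jLevel h0'.ne').tendsto).const_mul (ellH a' b')).eventually_lt_const hB'
  have hev4' : ∀ᶠ t in 𝓝[<] ρ', t ∈ Ioo 0 ρ' := Ioo_mem_nhdsLT h0'
  obtain ⟨r', ⟨hr'0, hr'ρ⟩, hBr'⟩ :=
    (hev4'.and (hev4.filter_mono nhdsWithin_le_nhds)).exists
  have hr'1 : r' < 1 := hr'ρ.trans h1'
  -- `ρ < ρ₁ < 1` (only needed to run the scaling on `F`)
  obtain ⟨ρ₁, hρρ₁, hρ₁1⟩ : ∃ ρ₁, ρ < ρ₁ ∧ ρ₁ < 1 := ⟨(ρ + 1) / 2, by linarith, by linarith⟩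
  have h0ρ₁ : 0 < ρ₁ := h0.trans hρρ₁
  have hBρ₁ : ellH a b * jLevel ρ₁ < ellC a b :=
    (mul_lt_mul_of_pos_left (jLevel_lt_jLevel h0 hρρ₁ hρ₁1.le) hh).trans hB
  -- confocal rooms
  obtain ⟨θ₁, hθ₁, hroom₁⟩ := exists_thickening_ellHull_subset hab h0 hρρ₁ hρ₁1.le
  obtain ⟨θ₂, hθ₂, hroom₂⟩ := exists_thickening_ellHull_subset hab hr0 hrρ h1.le
  obtain ⟨θ₁', hθ₁', hroom₁'⟩ := exists_thickening_ellHull_subset hab' h0' hρρ₁' hρ₁'1.le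
  obtain ⟨θ₂', hθ₂', hroom₂'⟩ := exists_thickening_ellHull_subset hab' hr'0 hr'ρ h1'.le
  -- boundary scaling on `F`
  have hU := fun φ hφ ↦ stub_flatUniformizerDeriv F r₀ hr₀ hF0 hflat φ hφ
  have hU' := fun φ hφ ↦ stub_flatUniformizerDeriv F' r₀' hr₀' hF'0 hflat' φ hφ
  have hS := stub_flatBoundaryScaling F r₀ hr₀ hF0 hflat hU μ hμ (ellHull a b ρ₁) (ellHull a b ρ)
    (ellHull a b r) (min θ₁ θ₂) (lt_min hθ₁ hθ₂) (isStarHull_ellHull hab h0ρ₁ hρ₁1 hBρ₁)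
    (isStarHull_ellHull hab hr0 hr1 hBr)
    (Metric.isCompact_of_isClosed_isBounded (isClosed_ellHull a b ρ) (isBounded_ellHull hab ρ))
    (fun z hz ↦ by rw [hcl]; exact hz.2)
    (fun z hz ↦ hroom₁ ⟨Metric.thickening_mono (min_le_left _ _) _ hz.1, hz.2⟩)
    (fun z hz ↦ hroom₂ ⟨Metric.thickening_mono (min_le_right _ _) _ hz.1, hz.2⟩)
    (ellConf hab h0ρ₁ hρ₁1.le hBρ₁) (ellDeriv a b ρ₁) (isRestrictionMap_ellConf hab h0ρ₁ hρ₁1 hBρ₁)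
    (hasRestrictionDeriv_ellConf hab h0ρ₁ hρ₁1 hBρ₁)
    (ellConf hab hr0 hr1.le hBr) (ellDeriv a b r) (isRestrictionMap_ellConf hab hr0 hr1 hBr)
    (hasRestrictionDeriv_ellConf hab hr0 hr1 hBr)
  -- boundary scaling on `F'`
  have hS' := stub_flatBoundaryScaling F' r₀' hr₀' hF'0 hflat' hU' μ' hμ' (ellHull a' b' ρ₁')
    (ellHull a' b' ρ') (ellHull a' b' r') (min θ₁' θ₂') (lt_min hθ₁' hθ₂')
    (isStarHull_ellHull hab' h0ρ₁' hρ₁'1 hBρ₁') (isStarHull_ellHull hab' hr'0 hr'1 hBr')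
    (Metric.isCompact_of_isClosed_isBounded (isClosed_ellHull a' b' ρ') (isBounded_ellHull hab' ρ'))
    (fun z hz ↦ by rw [hcl]; exact hz.2)
    (fun z hz ↦ hroom₁' ⟨Metric.thickening_mono (min_le_left _ _) _ hz.1, hz.2⟩)
    (fun z hz ↦ hroom₂' ⟨Metric.thickening_mono (min_le_right _ _) _ hz.1, hz.2⟩)
    (ellConf hab' h0ρ₁' hρ₁'1.le hBρ₁') (ellDeriv a' b' ρ₁')
    (isRestrictionMap_ellConf hab' h0ρ₁' hρ₁'1 hBρ₁') (hasRestrictionDeriv_ellConf hab' h0ρ₁' hρ₁'1 hBρ₁')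
    (ellConf hab' hr'0 hr'1.le hBr') (ellDeriv a' b' r') (isRestrictionMap_ellConf hab' hr'0 hr'1 hBr')
    (hasRestrictionDeriv_ellConf hab' hr'0 hr'1 hBr')
  -- a common small `ε`
  have hevε : ∀ᶠ ε in 𝓝[>] (0 : ℝ), ε ∈ Ioi 0 := eventually_mem_nhdsWithin
  obtain ⟨ε, hε, ⟨hlow, -⟩, ⟨-, hup⟩⟩ := (hevε.and (hS.and hS')).exists
  have hε' : (0 : ℝ) < ε := hε
  have key := hlow.trans ((heq ε hε').le.trans hup)
  have hpos₁ := (ellDeriv_pos_le hab' h0ρ₁' hρ₁'1.le hBρ₁').1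
  have hposr := (ellDeriv_pos_le hab hr0 hr1.le hBr).1
  rw [ENNReal.ofReal_le_ofReal_iff (Real.rpow_nonneg hpos₁.le _),
    Real.rpow_le_rpow_iff hposr.le hpos₁.le (by norm_num : (0 : ℝ) < 5 / 8)] at key
  linarith

/-! ### Transport of the avoidance events under the stretch -/

/-- **The avoidance events correspond under `Φ_s`.** For `0 < β < α < 1` with `sβ < α` and every
`ε`: `μ {Γ avoids ε E(α, β)} = (Φ_s)_* μ {Γ avoids ε E(α, sβ)}`, because
`Φ_s⁻¹ (ε E(α, sβ)) = ε E(α, β)` (`stretch_preimage_ell`, in the axis form of `ell_dict`). -/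
theorem avoid_stretch_eq {s : ℝ} (hs : 0 < s) (Φs : ℂ ≃ₜ ℂ)
    (hΦs : ∀ z : ℂ, Φs z = (z.re : ℂ) + ((s * z.im : ℝ) : ℂ) * Complex.I)
    (μ : Measure (CurveClass ℂ)) {α β : ℝ} (hβ : 0 < β) (hβα : β < α) (hsβα : s * β < α)
    (hα1 : α < 1) (ε : ℝ) :
    μ (CurveClass.rangeSubset ((fun z : ℂ => (ε : ℂ) * z) ''
        ellHull (1 - Real.sqrt (α ^ 2 - β ^ 2)) (1 + Real.sqrt (α ^ 2 - β ^ 2))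
          (Real.sqrt ((α - β) / (α + β))))ᶜ) =
      (μ.map (CurveClass.map (Φs : C(ℂ, ℂ))))
        (CurveClass.rangeSubset ((fun z : ℂ => (ε : ℂ) * z) ''
          ellHull (1 - Real.sqrt (α ^ 2 - (s * β) ^ 2)) (1 + Real.sqrt (α ^ 2 - (s * β) ^ 2))
            (Real.sqrt ((α - s * β) / (α + s * β))))ᶜ) := by
  have hsβ : 0 < s * β := mul_pos hs hβ
  obtain ⟨-, -, -, -, hax⟩ := ell_dict hβ hβα hα1
  obtain ⟨-, -, -, -, hax'⟩ := ell_dict hsβ hsβα hα1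
  rw [hax, hax']
  have hKc : IsCompact ((fun z : ℂ => (ε : ℂ) * z) ''
      {z : ℂ | 0 ≤ z.im ∧ ((z.re - 1) / α) ^ 2 + (z.im / (s * β)) ^ 2 ≤ 1}) :=
    (ell_axis_compact_subset (hβ.trans hβα) hsβ).1.image (continuous_const_mul _)
  rw [Measure.map_apply (CurveClass.measurable_map _)
      (CurveClass.measurableSet_rangeSubset_compl hKc.isClosed),
    preimage_map_rangeSubset_compl, stretch_preimage_ell hs hβ Φs hΦs]

end Stretch

open Stretch

/-! ### The registered stub -/

/-- Stub `stub_stretchRigidity` (= item stmt-CriticalPhenomena-5793 verbatim). **Chordal SLE(8/3)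
admits no axis-stretch covariance**: if `s > 0` and the stretch `Φ_s (x + iy) = x + i s y` pushes
every chordal SLE(8/3) law of every Dobrushin domain `D` to a chordal SLE(8/3) law of `Φ_s(D)`,
then `s = 1`. Proof: on the flat square `F` of `stub_flatRectangle` with an SLE(8/3) law `μ` and
its image `(Φ_s)_* μ` (an SLE(8/3) law of `Φ_s F` by hypothesis), the restriction derivatives of
the half-ellipse hulls centred at the marked point's neighbour `1` satisfy `g(α, β) = g(α, sβ)`
(`avoid_stretch_eq`, `ellDeriv_le_of_avoid`); iterating along `t = min (s, 1/s)` and flattening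
(`tendsto_ellDeriv_flattening`) gives `g(α, β) = 1`, contradicting `ellDeriv_lt_one`. -/
theorem stub_stretchRigidity : SAWBrickWallHomotopy.StretchRigidity := by
  intro s hs hcov
  by_contra hs1
  -- the stretch homeomorphism `Φ_s`
  have hcont : ∀ c : ℝ, Continuous fun z : ℂ ↦ (z.re : ℂ) + ((c * z.im : ℝ) : ℂ) * Complex.I :=
    fun c ↦ (Complex.continuous_ofReal.comp Complex.continuous_re).add
      ((Complex.continuous_ofReal.comp (continuous_const.mul Complex.continuous_im)).mul
        continuous_const)
  let Φs : ℂ ≃ₜ ℂ :=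
    { toFun := fun z ↦ (z.re : ℂ) + ((s * z.im : ℝ) : ℂ) * Complex.I
      invFun := fun z ↦ (z.re : ℂ) + ((s⁻¹ * z.im : ℝ) : ℂ) * Complex.I
      left_inv := fun z ↦ by
        apply Complex.ext <;> simp [hs.ne']
      right_inv := fun z ↦ by
        apply Complex.ext <;> simp [hs.ne']
      continuous_toFun := hcont s
      continuous_invFun := hcont s⁻¹ }
  have hΦs : ∀ z : ℂ, Φs z = (z.re : ℂ) + ((s * z.im : ℝ) : ℂ) * Complex.I := fun z ↦ rfl
  -- the flat square, its stretched image and their SLE(8/3) laws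
  obtain ⟨F, r₀, hr₀, hF0, hflat, hstretch⟩ := stub_flatRectangle
  have hflat' := hstretch s hs Φs hΦs
  have hr₀' : 0 < min r₀ (s * r₀) := lt_min hr₀ (mul_pos hs hr₀)
  have hF'0 : (F.map Φs).pt 0 = 0 := by
    rw [MarkedDomain.pt_map, hF0, hΦs]
    simp
  obtain ⟨μ, hμ⟩ := exists_isSLELaw_of_ne_eight (κ := (8 : ℝ≥0) / 3) (by positivity)
    eightThirds_ne_eight F
  have hμ' := hcov Φs hΦs F μ hμ
  -- the restriction derivatives `g β` of the hulls `E(1/2, β)` and the identity `g β = g (s β)`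
  have hα0 : (0 : ℝ) < 1 / 2 := by norm_num
  have hα1 : (1 : ℝ) / 2 < 1 := by norm_num
  set g : ℝ → ℝ := fun β ↦ ellDeriv (1 - Real.sqrt ((1 / 2) ^ 2 - β ^ 2))
    (1 + Real.sqrt ((1 / 2) ^ 2 - β ^ 2)) (Real.sqrt ((1 / 2 - β) / (1 / 2 + β))) with hg
  have key : ∀ β : ℝ, 0 < β → β < 1 / 2 → s * β < 1 / 2 → g β = g (s * β) := by
    intro β hβ hβα hsβα
    have hsβ : 0 < s * β := mul_pos hs hβ
    obtain ⟨hab, h0, h1, hB, -⟩ := ell_dict hβ hβα hα1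
    obtain ⟨hab', h0', h1', hB', -⟩ := ell_dict hsβ hsβα hα1
    exact le_antisymm
      (ellDeriv_le_of_avoid hr₀ hF0 hflat hr₀' hF'0 hflat' hμ hμ' hab h0 h1 hB hab' h0' h1' hB'
        fun ε _ ↦ avoid_stretch_eq hs Φs hΦs μ hβ hβα hsβα hα1 ε)
      (ellDeriv_le_of_avoid hr₀' hF'0 hflat' hr₀ hF0 hflat hμ' hμ hab' h0' h1' hB' hab h0 h1 hB
        fun ε _ ↦ (avoid_stretch_eq hs Φs hΦs μ hβ hβα hsβα hα1 ε).symm)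
  -- one step along `t = min s s⁻¹ < 1`
  set t : ℝ := min s s⁻¹ with ht
  have ht0 : 0 < t := lt_min hs (inv_pos.2 hs)
  have ht1 : t < 1 := by
    rcases lt_or_gt_of_ne hs1 with h | h
    · exact (min_le_left _ _).trans_lt h
    · exact (min_le_right _ _).trans_lt (inv_lt_one_of_one_lt₀ h)
  have step : ∀ β : ℝ, 0 < β → β < 1 / 2 → g (t * β) = g β := by
    intro β hβ hβα
    rcases le_or_gt s 1 with h | h
    · have hts : t = s := min_eq_left (h.trans (one_le_inv_iff₀.2 ⟨hs, h⟩))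
      rw [hts]
      exact (key β hβ hβα (by nlinarith)).symm
    · have hts : t = s⁻¹ := min_eq_right ((inv_le_one_of_one_le₀ h.le).trans h.le)
      rw [hts]
      have h1 : s * (s⁻¹ * β) = β := by field_simp
      have h2 : s⁻¹ * β < β := by
        have : s⁻¹ < 1 := inv_lt_one_of_one_lt₀ h
        nlinarith
      have := key (s⁻¹ * β) (by positivity) (h2.trans hβα) (by rw [h1]; exact hβα)
      rw [h1] at this
      exact this
  -- iterate and flatten: `g (tⁿ/4) = g (1/4)` tends to `1`
  have iter : ∀ n : ℕ, g (t ^ n * (1 / 4)) = g (1 / 4) := by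
    intro n
    induction n with
    | zero => rw [pow_zero, one_mul]
    | succ n ih =>
      have hle : t ^ n * (1 / 4) < 1 / 2 := by
        have := pow_le_one₀ (n := n) ht0.le ht1.le
        nlinarith
      rw [pow_succ', mul_assoc, step _ (by positivity) hle, ih]
  have hlim : Tendsto (fun n : ℕ ↦ g (t ^ n * (1 / 4))) atTop (𝓝 1) := by
    have h1 : Tendsto (fun n : ℕ ↦ t ^ n * (1 / 4)) atTop (𝓝[>] 0) := by
      refine tendsto_nhdsWithin_iff.2 ⟨?_, Eventually.of_forall fun n ↦ ?_⟩
      · simpa using (tendsto_pow_atTop_nhds_zero_of_lt_one ht0.le ht1).mul_const (1 / 4 : ℝ)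
      · exact mul_pos (pow_pos ht0 n) (by norm_num)
    exact (tendsto_ellDeriv_flattening hα0 hα1).comp h1
  have hg1 : g (1 / 4) = 1 :=
    tendsto_nhds_unique tendsto_const_nhds (hlim.congr fun n ↦ iter n)
  -- but `g (1/4) < 1`
  obtain ⟨hab, h0, h1, hB, -⟩ := ell_dict (α := 1 / 2) (β := 1 / 4) (by norm_num) (by norm_num) hα1
  have hlt := ellDeriv_lt_one hab h0 h1 hB
  simp only [hg] at hg1
  linarith

end Summit.CriticalPhenomena.SAWScalingLimit.Cruxes.HexTransfer.PinTheShear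

end
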